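import Mathlib
import HarnessLib
import Literature.Computability.AlgebraicComplexity.ArithCircuitProofs
import Literature.Barriers.ValiantsHypothesis.MonotoneGap
import Summits.ValiantsHypothesis.ValiantsHypothesis.Theorems.PerDivisionHard.Negative.PlainBridge

/-!
# `complexity` over `ℝ≥0` versus Jerrum–Snir monotone computations (crux `stmt-ValiantsHypothesis-15886`, F4)

Helper file (`--supports stmt-ValiantsHypothesis-15886`) of line `Sketch`, lead c2, stub
`stub_monotoneComputation_of_complexity`.

The crux `MonotoneRestorationQP` measures monotone complexity by the tree's
`complexity (k := ℝ≥0) f`: the least number of gates of a fan-in-two `ArithCircuit ℝ≥0 σ` with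
WEIGHTED sum gates `c • u + d • v` (nonnegative weights) and product gates.  Jerrum–Snir's model
in the barrier catalogue (`Literature.Barriers.ValiantsHypothesis.IsMonotoneComputation`,
`MonotoneGap.lean`) is PLAIN: fan-in-two, every sum coefficient equal to `1`, constants entering
only as input operands (Jerrum–Snir 1982, §2.2: internal nodes "all have indegree 2 and are
labeled either by `⊕` or `⊗`").  A plain computation of size `s` is in particular a weighted one,
so `complexity f ≤ s`; this file proves the converse up to the factor `3`:

* `stub_monotoneComputation_of_complexity` — every `f : MvPolynomial σ ℝ≥0` has a Jerrum–Snir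
  monotone computation of size `≤ 3 · complexity f`.

Proof: take a fan-in-two circuit `P` of size exactly `complexity f`
(`ArithCircuit.exists_computes_size_eq_complexity`) and expand it gate by gate, old gate `i`
becoming the three new gates `3i, 3i+1, 3i+2` with the old value carried by gate `3i+2`
(`c • u + d • v ↦ (c ⊗ u'), (d ⊗ v'), gate 3i ⊕ gate (3i+1)`; references re-indexed
`j ↦ 3j+2`).  This translation, with its semantic invariant, is already in the tree as the
internal construction `Plainify.circuit` of
`Summits/ValiantsHypothesis/ValiantsHypothesis/Theorems/PerDivisionHard/Negative/PlainBridge.lean`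
(`Plainify.computes`, `Plainify.length_gatesAux : |gatesAux i gs| = 3 |gs|`,
`Plainify.fanIn_of_mem_triple`, `Plainify.isPlainGate_of_mem_triple`), whose exported bridge
`exists_plain_of_computes` only records the `⊗`-count `≤ 2 s`; here we read off the size `3 s`.

## References

* [JerrumSnir1982] M. Jerrum, M. Snir, *Some exact complexity results for straight-line
  computations over semirings*, J. ACM 29 (1982) 874–897, §2.2.
-/

set_option linter.dupNamespace false

noncomputable section

namespace Summit.ValiantsHypothesis.ValiantsHypothesis.Theorems

open Literature.Computability.AlgebraicComplexity Literature.Barriers.ValiantsHypothesis MvPolynomial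

/-- **`complexity` over `ℝ≥0` is Jerrum–Snir's plain monotone size up to a factor `3`.** Every
polynomial with nonnegative real coefficients has a monotone computation in the sense of
Jerrum–Snir (fan-in two, all sum coefficients `1`, `IsMonotoneComputation`) with at most
`3 · complexity f` gates: expand each weighted sum gate `c • u + d • v` of a size-optimal
fan-in-two circuit into `(c ⊗ u) ⊕ (d ⊗ v)` — two products by constant inputs and one plain sum —
padding every old gate to a block of exactly three new gates (`Plainify.circuit` of
`PlainBridge.lean`). Hence every Jerrum–Snir lower bound of the barrier catalogue bounds the
crux's `complexity` from below, up to the factor `3`. [cite: JerrumSnir1982, §2.2] -/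
theorem stub_monotoneComputation_of_complexity {σ : Type} (f : MvPolynomial σ NNReal) :
    ∃ P : ArithCircuit NNReal σ,
      Literature.Barriers.ValiantsHypothesis.IsMonotoneComputation P f ∧
      P.size ≤ 3 * complexity f := by
  obtain ⟨P, h2, hf, hs⟩ := ArithCircuit.exists_computes_size_eq_complexity f
  refine ⟨Summit.ValiantsHypothesis.Theorems.PerDivisionHardNegative.Plainify.circuit P,
    ⟨?_, ?_, Summit.ValiantsHypothesis.Theorems.PerDivisionHardNegative.Plainify.computes h2 hf⟩,
    ?_⟩
  · -- fan-in two is preserved blockwise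
    intro g' hg'
    obtain ⟨j, g, hg, hj⟩ :=
      Summit.ValiantsHypothesis.Theorems.PerDivisionHardNegative.Plainify.mem_gatesAux hg'
    exact Summit.ValiantsHypothesis.Theorems.PerDivisionHardNegative.Plainify.fanIn_of_mem_triple
      (h2 g hg) hj
  · -- every new gate is plain
    intro g' hg'
    obtain ⟨j, g, -, hj⟩ :=
      Summit.ValiantsHypothesis.Theorems.PerDivisionHardNegative.Plainify.mem_gatesAux hg'
    exact
      Summit.ValiantsHypothesis.Theorems.PerDivisionHardNegative.Plainify.isPlainGate_of_mem_triple hj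
  · -- size: exactly three new gates per old gate
    rw [← hs]
    exact (Summit.ValiantsHypothesis.Theorems.PerDivisionHardNegative.Plainify.length_gatesAux 0
      P.gates).le

end Summit.ValiantsHypothesis.ValiantsHypothesis.Theorems

end
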